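import Summits.QuantumFields.YangMills.Theorems.MirrorModularBoostsSoftKernelBoostCovarianceOfInputs

/-!
# `SoftKernelBoostCovariance`: the POINTWISE composition of line `Sketch` — planar invariance of ONE family from its inputs

Line `Sketch` of crux `MirrorModularBoosts.SoftKernelBoostCovariance` (stmt-QuantumFields-14999; route-QuantumFields-MirrorModularBoosts),
continuation lead c3.  The landed composition `stub_cruxOfInputs` (p135724) consumes the two Yang–Mills inputs of the line as GLOBAL
statements, and its Step 0 antecedent (`W1 → EightFrameRP → PlanarCone → NPointRegular`) does not carry the soft two-point kernel,
although the crux supplies it.  This file records the sharper, purely model-blind form that a re-lined engine can consume verbatim: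

* `levelGrowthLow_of_kernel_pointwise` — the level-`≤ 1` growth from the kernel triple, with only E3, proper-hypercubic invariance and
  the eight frames as hypotheses (no gauge group, no scheme);
* `stub_planarInvariantOfInputs` — **for ONE one-species family `S₁`**: OS package, translations, proper-hypercubic invariance, the eight
  frames, the planar cone, the kernel triple, `NPointRegular S₁` and the two sandwich bounds (for `S₁` and for its `45°` pull-back)
  imply `PlanarInvariant S₁`.  Nothing about `G`, `r`, `sch` or the lattice tie is used: the tie enters the crux ONLY through the two
  inputs (consistent with `Negative.not_softKernelModelBlind`: the junk family is not `NPointRegular`);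
* `cruxOfInputsK` — the crux from Step 0 **with the kernel triple as an extra antecedent** (strictly weaker than the registered
  `stub_tieRegularity`, and the form in which the crux can use it: degree `2` is then free) and Σ;
* `crux_of_pointwiseInputs` — the crux from the conjunction of the three inputs, supplied pointwise after the crux's own hypotheses.

Everything is re-assembled from landed files (p100538, p102333, p102747, p96941, p97905, p135459, p135579, p135724).
-/

noncomputable section

namespace Summit.QuantumFields.YangMills.Theorems.SoftKernelBoostCovariance.Sketch

open scoped BigOperators SchwartzMap InnerProductSpace
open MeasureTheory Filter Topology
open Literature.MathematicalPhysics.QuantumLattice Literature.MathematicalPhysics.AQFT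
  Literature.MathematicalPhysics.QuantumFieldTheory
open Summit.QuantumFields.YangMills.Theorems.NPointIsotropy.Negative (E4 NPointRegular)
open Summit.QuantumFields.YangMills.Theorems.CurvatureBoostCovariance.Negative
  (OSPackage Translations Hypercubic EightFrameRP PlanarCone PlanarInvariant Tie Gaps W1)
open Summit.QuantumFields.YangMills.Theorems.CurvatureBoostCovariance.BoostsInheritMirrors
  (stub_orbitBandlimit stub_rayPositivity stub_doubledToInvariant stub_tensorDensity stub_paritySieve
    trigPoly_coeff_eq_zero_of_const)
open Summit.QuantumFields.YangMills.Theorems.CurvatureBoostCovariance.BoostsInheritMirrors.RayPositivity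
  (pencil_eq_inner orbit_eq_inner osReconstruction_of exists_isTimeOrdered_planeRot translations_pullBack
    isSymmetric_pullBack hasLinearGrowth_pullBack isReflectionPositive_pullBack eightFrameRP_pullBack planarCone_pullBack)

/-- **Level growth at levels `a ≤ 1` from the kernel triple — pointwise, model-blind form** (E3 + proper-hypercubic invariance +
the eight frames + the kernel triple: the landed `KernelTransfer` and `ShellRigidity_proof` make the two-point kernel radial, so the
degree-`2` doubled orbit is constant and its non-zero layers vanish; `a = 0` is trivial).  Verbatim the landed
`levelGrowthLow_of_kernel` with the package `W1` replaced by the two clauses it actually uses. -/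
theorem levelGrowthLow_of_kernel_pointwise {S₁ : SchwingerFamily E4}
    (hsym : S₁.toLabelled.IsSymmetric) (hhyp : Hypercubic S₁) (h8 : EightFrameRP S₁)
    (hK : ∃ (K : E4 → ℝ) (C η : ℝ), 0 < η ∧ ContinuousOn K {x : E4 | x ≠ 0} ∧
      (∀ x : E4, x ≠ 0 → |K x| ≤ C * (1 + ‖x‖ ^ (η - 10))) ∧
      ∀ F : 𝓢((Fin 2 → E4), ℂ), IsOffDiagonal F →
        MeasureTheory.Integrable (fun x : Fin 2 → E4 => (K (x 0 - x 1) : ℂ) * F x) ∧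
          S₁ 2 F = ∫ x : Fin 2 → E4, (K (x 0 - x 1) : ℂ) * F x) :
    ∀ a : ℕ, a ≤ 1 →
      ∀ (F : 𝓢((Fin a → E4), ℂ)), IsTimeOrdered F →
      ∀ H : 𝓢((Fin (a + a) → E4), ℂ), IsAppendTensorOf H (osAdjoint F) F →
      ∀ (K : ℕ) (p : ℤ → ℂ),
        (∀ θ : ℝ, S₁ (a + a) (linActMulti (planeRot (0 : Fin 3) θ) H) =
          ∑ k ∈ Finset.Icc (-(K : ℤ)) K, p k * Complex.exp (4 * (k : ℂ) * (θ : ℂ) * Complex.I)) →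
        ∀ k ∈ Finset.Icc (-(K : ℤ)) K, 2 ≤ |k| → p k = 0 := by
  intro a ha F hF H hH K p hp
  have hconst : ∀ θ : ℝ, S₁ (a + a) (linActMulti (planeRot (0 : Fin 3) θ) H) = S₁ (a + a) H := by
    obtain rfl | rfl : a = 0 ∨ a = 1 := by omega
    · intro θ
      congr 1
      ext x
      rw [linActMulti_apply]
      congr 1
      funext i
      exact Fin.elim0 i
    · obtain ⟨Kf, C, η, hη, hKc, hKb, hKrep⟩ := hK
      obtain ⟨hWB4, hax, hdiag⟩ :=
        Summit.QuantumFields.YangMills.Theorems.KernelTransfer.kernelTransfer_proof S₁ Kf hKc hKrep hsym hhyp h8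
      have hrad : Summit.QuantumFields.YangMills.Theorems.NPointIsotropy.Negative.RadialKernel S₁ :=
        ⟨Kf, hKc, fun R x hx =>
          Summit.QuantumFields.YangMills.Cruxes.ShellRigidity.TransverseSmearingPlanarThreshold.ShellRigidity_proof
            Kf hKc ⟨C, η, hη, hKb⟩ hWB4 hax hdiag R x hx, hKrep⟩
      have hHoff : IsOffDiagonal H := hH.isOffDiagonal_of_isTimeOrdered hF hF
      intro θ
      exact Summit.QuantumFields.YangMills.Theorems.NPointIsotropy.Negative.radialKernel_invariant_two hrad
        (planeRot (0 : Fin 3) θ) H hHoff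
  intro k hk hk2
  have hk0 : k ≠ 0 := by
    rintro rfl
    rw [abs_zero] at hk2
    exact absurd hk2 (by norm_num)
  exact trigPoly_coeff_eq_zero_of_const K p (S₁ (a + a) H) (fun θ => (hp θ).symm.trans (hconst θ)) k hk hk0

/-- **PLANAR INVARIANCE OF ONE FAMILY FROM ITS INPUTS (the pointwise, model-blind composition of line `Sketch`).**
For a one-species family `S₁` on `ℝ⁴` with the OS package, translations and proper-hypercubic invariance on `⁰𝒮`,
reflection positivity in the eight planar frames, the planar spectral cone and the soft two-point kernel triple: IF every
`𝔖ₙ|⁰𝒮` is a function (`NPointRegular S₁`, Step 0) and the transversely filtered heat-sandwich bound with exponent `μ < 4` holds for every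
`e₀`-reconstruction of `S₁` and of its `45°` pull-back (Σ), THEN `S₁` is invariant on `⁰𝒮` under every rotation of the
`(x₀,x₁)`-plane.  Proof = the landed chain: reconstructions (`osReconstruction_of`, `*_pullBack`, `PlanarSpectralCone_of`), cone
families (`stub_coneFamily`), `sandwich_mono_exponent`, uniform and typed boost vectors (`stub_asmUniformBoost`,
`stub_asmTypedBoost`), band limit and ray positivity (`stub_orbitBandlimitLocal`, `stub_rayPositivityLocal`), level growth
(`levelGrowthLow_of_kernel_pointwise`, `stub_levelGrowthHigh_of_boostType`, `stub_laurentLayers`) and the parity sieve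
(`sieve_of_stubs`). -/
theorem stub_planarInvariantOfInputs :
    open Literature.MathematicalPhysics.QuantumLattice Literature.MathematicalPhysics.AQFT
      Literature.MathematicalPhysics.QuantumFieldTheory
      Summit.QuantumFields.YangMills.Theorems.CurvatureBoostCovariance.Negative
      Summit.QuantumFields.YangMills.Theorems.NPointIsotropy.Negative in
    ∀ (S₁ : SchwingerFamily E4), OSPackage S₁ → Translations S₁ → Hypercubic S₁ → EightFrameRP S₁ → PlanarCone S₁ →
      (∃ (K : E4 → ℝ) (C η : ℝ), 0 < η ∧ ContinuousOn K {x : E4 | x ≠ 0} ∧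
        (∀ x : E4, x ≠ 0 → |K x| ≤ C * (1 + ‖x‖ ^ (η - 10))) ∧
        ∀ F : SchwartzMap (Fin 2 → E4) ℂ, IsOffDiagonal F →
          MeasureTheory.Integrable (fun x : Fin 2 → E4 => (K (x 0 - x 1) : ℂ) * F x) ∧
            S₁ 2 F = ∫ x : Fin 2 → E4, (K (x 0 - x 1) : ℂ) * F x) →
      NPointRegular S₁ →
      (∀ (h : OSReconstructionNoE1 S₁.toLabelled), ∃ μ C : ℝ, μ < 4 ∧
        (∀ (u v : ℝ), 0 < u → 0 < v → u ≤ 1 → v ≤ 1 →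
           ∀ (f₁ : SchwartzMap (Fin 1 → E4) ℂ) (g hh : ℝ × ℝ → ℂ) (Mg Mh Mh' : ℝ),
             (∀ x : Fin 1 → E4, f₁ x = g (x 0 0, x 0 1) * hh (x 0 2, x 0 3)) →
             (∀ p : ℝ × ℝ, g p ≠ 0 → u ≤ p.1 ∧ p.1 ≤ 2 * u) →
             MeasureTheory.Integrable g → (∫ p, ‖g p‖) ≤ Mg →
             MeasureTheory.Integrable hh → (∫ p, ‖hh p‖) ≤ Mh → (∀ p, ‖hh p‖ ≤ Mh') →
           ∀ (n : ℕ) (W : SchwartzMap (Fin n → E4) ℂ) (hW : IsTimeOrdered W)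
             (hFW : IsTimeOrdered
               (SchwartzMap.appendTensor f₁ (translateMulti ((2 * u + v) • EuclideanSpace.single 0 1) W))),
             ‖h.fieldVec (1 + n) (fun _ => ())
                 (SchwartzMap.appendTensor f₁ (translateMulti ((2 * u + v) • EuclideanSpace.single 0 1) W)) hFW‖
               ≤ C * Mg * (Mh + Mh') * (u ^ (-μ) + v ^ (-μ)) * ‖h.fieldVec n (fun _ => ()) W hW‖)) →
      (∀ (h' : OSReconstructionNoE1 (SchwingerFamily.toLabelled
          (fun n => (S₁ n).comp (linActMulti (planeRot (0 : Fin 3) (Real.pi / 4)))))),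
        ∃ μ C : ℝ, μ < 4 ∧
        (∀ (u v : ℝ), 0 < u → 0 < v → u ≤ 1 → v ≤ 1 →
           ∀ (f₁ : SchwartzMap (Fin 1 → E4) ℂ) (g hh : ℝ × ℝ → ℂ) (Mg Mh Mh' : ℝ),
             (∀ x : Fin 1 → E4, f₁ x = g (x 0 0, x 0 1) * hh (x 0 2, x 0 3)) →
             (∀ p : ℝ × ℝ, g p ≠ 0 → u ≤ p.1 ∧ p.1 ≤ 2 * u) →
             MeasureTheory.Integrable g → (∫ p, ‖g p‖) ≤ Mg →
             MeasureTheory.Integrable hh → (∫ p, ‖hh p‖) ≤ Mh → (∀ p, ‖hh p‖ ≤ Mh') →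
           ∀ (n : ℕ) (W : SchwartzMap (Fin n → E4) ℂ) (hW : IsTimeOrdered W)
             (hFW : IsTimeOrdered
               (SchwartzMap.appendTensor f₁ (translateMulti ((2 * u + v) • EuclideanSpace.single 0 1) W))),
             ‖h'.fieldVec (1 + n) (fun _ => ())
                 (SchwartzMap.appendTensor f₁ (translateMulti ((2 * u + v) • EuclideanSpace.single 0 1) W)) hFW‖
               ≤ C * Mg * (Mh + Mh') * (u ^ (-μ) + v ^ (-μ)) * ‖h'.fieldVec n (fun _ => ()) W hW‖)) →
      PlanarInvariant S₁ := by
  intro S₁ hOS htr hhyp h8 hC hK hreg hSig hSigT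
  have hlow := levelGrowthLow_of_kernel_pointwise hOS.2.2.2.2.1 hhyp h8 hK
  have hlg := hOS.2.2.1
  have hRP := hOS.2.2.2.1
  have hsym := hOS.2.2.2.2.1
  -- the two reconstructions
  have h : OSReconstructionNoE1 S₁.toLabelled := osReconstruction_of hRP htr
  have hT : OSReconstructionNoE1 (SchwingerFamily.toLabelled
      (fun n => (S₁ n).comp (linActMulti (planeRot (0 : Fin 3) (Real.pi / 4))))) :=
    osReconstruction_of (isReflectionPositive_pullBack h8) (translations_pullBack htr _)
  have hPSC : Summit.QuantumFields.YangMills.Theses.MirrorModularBoosts.PlanarSpectralCone :=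
    Summit.QuantumFields.YangMills.Cruxes.PlanarSpectralCone.PositivityDiscToOperatorCone.PlanarSpectralCone_of
  -- cone families
  have hN := stub_coneFamily S₁ h hlg hsym htr h8
  have hNT := stub_coneFamily (fun n => (S₁ n).comp (linActMulti (planeRot (0 : Fin 3) (Real.pi / 4)))) hT
    (hasLinearGrowth_pullBack hlg _) (isSymmetric_pullBack hsym _) (translations_pullBack htr _) (eightFrameRP_pullBack h8)
  -- the sandwich bounds (the YM input), exponents made nonnegative (`sandwich_mono_exponent`)
  obtain ⟨μ₀, Cμ, hμ₀, hS₀⟩ := hSig h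
  obtain ⟨μT₀, CμT, -, hST₀⟩ := hSigT hT
  have hS := sandwich_mono_exponent h hS₀
  have hST := sandwich_mono_exponent hT hST₀
  have hμ : max μ₀ 0 < 4 := max_lt hμ₀ (by norm_num)
  -- the chain, for `S₁` and for `T`
  have huni := stub_asmUniformBoost S₁ h hlg hsym htr h8 hC hN (max μ₀ 0) Cμ hS
  have hsub := stub_asmTypedBoost S₁ h hlg hsym htr h8 hC hN (max μ₀ 0) Cμ hS (le_max_right _ _)
  have huniT := stub_asmUniformBoost (fun n => (S₁ n).comp (linActMulti (planeRot (0 : Fin 3) (Real.pi / 4)))) hT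
    (hasLinearGrowth_pullBack hlg _) (isSymmetric_pullBack hsym _) (translations_pullBack htr _) (eightFrameRP_pullBack h8)
    (planarCone_pullBack hPSC hlg hsym htr h8) hNT (max μT₀ 0) CμT hST
  -- band limit and ray positivity from the local stubs
  have hband := stub_orbitBandlimitLocal S₁ hOS htr hhyp h8 hC hreg (fun _ => huni)
  have hpos := stub_rayPositivityLocal S₁ hOS htr h8 (fun _ => boostVectors_of_uniform h huni)
    (fun _ => boostVectors_of_uniform hT huniT)
  -- level growth at every level
  have hgrow : ∀ a : ℕ,
      (∀ N : ℕ, N + 2 ≤ 2 * a → ∀ R : E4 ≃ₗᵢ[ℝ] E4,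
            LinearMap.det (R.toLinearEquiv : E4 →ₗ[ℝ] E4) = 1 →
            R (EuclideanSpace.single 2 1) = EuclideanSpace.single 2 1 →
            R (EuclideanSpace.single 3 1) = EuclideanSpace.single 3 1 →
            ∀ F : SchwartzMap (Fin N → E4) ℂ, IsOffDiagonal F → S₁ N (linActMulti R F) = S₁ N F) →
      ∀ (F : 𝓢((Fin a → E4), ℂ)), IsTimeOrdered F → HasCompactSupport (F : (Fin a → E4) → ℂ) →
      ∀ H : 𝓢((Fin (a + a) → E4), ℂ), IsAppendTensorOf H (osAdjoint F) F →
      ∀ (K : ℕ) (p : ℤ → ℂ),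
        (∀ θ : ℝ, S₁ (a + a) (linActMulti (planeRot (0 : Fin 3) θ) H) =
          ∑ k ∈ Finset.Icc (-(K : ℤ)) K, p k * Complex.exp (4 * (k : ℂ) * (θ : ℂ) * Complex.I)) →
        ∀ k ∈ Finset.Icc (-(K : ℤ)) K, 2 ≤ |k| → p k = 0 := by
    intro a hInv F hF hFc H hH K p hp
    by_cases ha : a ≤ 1
    · exact hlow a ha F hF H hH K p hp
    · obtain ⟨ε, hε, V, C', hVd, hVg, hVeq⟩ := hsub a (by omega) hInv F hF hFc
      exact stub_levelGrowthHigh_of_boostType stub_laurentLayers S₁ h a F hF hFc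
        ⟨ε, hε, V, C', max μ₀ 0, hμ, hVd, hVg, hVeq⟩ H hH K p hp
  exact sieve_of_stubs S₁ hOS htr hreg hband hpos hgrow

/-- **THE CRUX FROM STEP 0 (WITH THE KERNEL ANTECEDENT) AND Σ.**  As the landed `stub_cruxOfInputs`, but the regularity input is
asked only of families that ALSO carry the soft two-point kernel triple — the form the crux can feed (its own fourth hypothesis),
and a strictly weaker Yang–Mills statement than the registered `stub_tieRegularity` (degree `2` is then free). -/
theorem cruxOfInputsK :
    open Literature.MathematicalPhysics.QuantumLattice Literature.MathematicalPhysics.AQFT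
      Literature.MathematicalPhysics.QuantumFieldTheory
      Summit.QuantumFields.YangMills.Theorems.CurvatureBoostCovariance.Negative
      Summit.QuantumFields.YangMills.Theorems.NPointIsotropy.Negative in
    (    ∀ (G : Type) [Group G] [TopologicalSpace G] [IsTopologicalGroup G] [CompactSpace G]
       [MeasurableSpace G] [BorelSpace G], IsCompactSimpleLieGroup G →
       ∀ (r : LatticeRep G) (sch : SpeciesScheme (YMSpecies G)) (S₁ : SchwingerFamily E4),
         W1 r sch S₁ → EightFrameRP S₁ → PlanarCone S₁ →
         (∃ (K : E4 → ℝ) (C η : ℝ), 0 < η ∧ ContinuousOn K {x : E4 | x ≠ 0} ∧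
           (∀ x : E4, x ≠ 0 → |K x| ≤ C * (1 + ‖x‖ ^ (η - 10))) ∧
           ∀ F : SchwartzMap (Fin 2 → E4) ℂ, IsOffDiagonal F →
             MeasureTheory.Integrable (fun x : Fin 2 → E4 => (K (x 0 - x 1) : ℂ) * F x) ∧
               S₁ 2 F = ∫ x : Fin 2 → E4, (K (x 0 - x 1) : ℂ) * F x) →
         NPointRegular S₁) →
    (    ∀ (G : Type) [Group G] [TopologicalSpace G] [IsTopologicalGroup G] [CompactSpace G]
       [MeasurableSpace G] [BorelSpace G], IsCompactSimpleLieGroup G →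
       ∀ (r : LatticeRep G) (sch : SpeciesScheme (YMSpecies G)) (S₁ : SchwingerFamily E4),
         W1 r sch S₁ → EightFrameRP S₁ → PlanarCone S₁ →
         (∃ (K : E4 → ℝ) (C η : ℝ), 0 < η ∧ ContinuousOn K {x : E4 | x ≠ 0} ∧
           (∀ x : E4, x ≠ 0 → |K x| ≤ C * (1 + ‖x‖ ^ (η - 10))) ∧
           ∀ F : SchwartzMap (Fin 2 → E4) ℂ, IsOffDiagonal F →
             MeasureTheory.Integrable (fun x : Fin 2 → E4 => (K (x 0 - x 1) : ℂ) * F x) ∧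
               S₁ 2 F = ∫ x : Fin 2 → E4, (K (x 0 - x 1) : ℂ) * F x) →
         (∀ (h : OSReconstructionNoE1 S₁.toLabelled), ∃ μ C : ℝ, μ < 4 ∧
           (∀ (u v : ℝ), 0 < u → 0 < v → u ≤ 1 → v ≤ 1 →
              ∀ (f₁ : SchwartzMap (Fin 1 → E4) ℂ) (g hh : ℝ × ℝ → ℂ) (Mg Mh Mh' : ℝ),
                (∀ x : Fin 1 → E4, f₁ x = g (x 0 0, x 0 1) * hh (x 0 2, x 0 3)) →
                (∀ p : ℝ × ℝ, g p ≠ 0 → u ≤ p.1 ∧ p.1 ≤ 2 * u) →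
                MeasureTheory.Integrable g → (∫ p, ‖g p‖) ≤ Mg →
                MeasureTheory.Integrable hh → (∫ p, ‖hh p‖) ≤ Mh → (∀ p, ‖hh p‖ ≤ Mh') →
              ∀ (n : ℕ) (W : SchwartzMap (Fin n → E4) ℂ) (hW : IsTimeOrdered W)
                (hFW : IsTimeOrdered
                  (SchwartzMap.appendTensor f₁ (translateMulti ((2 * u + v) • EuclideanSpace.single 0 1) W))),
                ‖h.fieldVec (1 + n) (fun _ => ())
                    (SchwartzMap.appendTensor f₁ (translateMulti ((2 * u + v) • EuclideanSpace.single 0 1) W)) hFW‖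
                  ≤ C * Mg * (Mh + Mh') * (u ^ (-μ) + v ^ (-μ)) * ‖h.fieldVec n (fun _ => ()) W hW‖)) ∧
         (∀ (h' : OSReconstructionNoE1 (SchwingerFamily.toLabelled
             (fun n => (S₁ n).comp (linActMulti (planeRot (0 : Fin 3) (Real.pi / 4)))))),
           ∃ μ C : ℝ, μ < 4 ∧
           (∀ (u v : ℝ), 0 < u → 0 < v → u ≤ 1 → v ≤ 1 →
              ∀ (f₁ : SchwartzMap (Fin 1 → E4) ℂ) (g hh : ℝ × ℝ → ℂ) (Mg Mh Mh' : ℝ),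
                (∀ x : Fin 1 → E4, f₁ x = g (x 0 0, x 0 1) * hh (x 0 2, x 0 3)) →
                (∀ p : ℝ × ℝ, g p ≠ 0 → u ≤ p.1 ∧ p.1 ≤ 2 * u) →
                MeasureTheory.Integrable g → (∫ p, ‖g p‖) ≤ Mg →
                MeasureTheory.Integrable hh → (∫ p, ‖hh p‖) ≤ Mh → (∀ p, ‖hh p‖ ≤ Mh') →
              ∀ (n : ℕ) (W : SchwartzMap (Fin n → E4) ℂ) (hW : IsTimeOrdered W)
                (hFW : IsTimeOrdered
                  (SchwartzMap.appendTensor f₁ (translateMulti ((2 * u + v) • EuclideanSpace.single 0 1) W))),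
                ‖h'.fieldVec (1 + n) (fun _ => ())
                    (SchwartzMap.appendTensor f₁ (translateMulti ((2 * u + v) • EuclideanSpace.single 0 1) W)) hFW‖
                  ≤ C * Mg * (Mh + Mh') * (u ^ (-μ) + v ^ (-μ)) * ‖h'.fieldVec n (fun _ => ()) W hW‖))) →
    Summit.QuantumFields.YangMills.Theses.MirrorModularBoosts.SoftKernelBoostCovariance := by
  intro h0 hSig0
  rw [Summit.QuantumFields.YangMills.Theorems.SoftKernelBoostCovariance.Negative.softKernelBoostCovariance_iff]
  intro G _ _ _ _ hG
  letI : MeasurableSpace G := borel G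
  haveI : BorelSpace G := ⟨rfl⟩
  intro r sch S₁ hW h8 hC hK
  obtain ⟨_, hOS, htr, hhyp, -⟩ := id hW
  obtain ⟨hSig, hSigT⟩ := hSig0 G hG r sch S₁ hW h8 hC hK
  exact stub_planarInvariantOfInputs S₁ hOS htr hhyp h8 hC hK (h0 G hG r sch S₁ hW h8 hC hK) hSig hSigT

/-- **THE CRUX FROM ITS INPUTS SUPPLIED POINTWISE**: if every family meeting the crux's hypotheses (`W1`, the eight frames, the
cone, the kernel triple) is `NPointRegular` and satisfies the two sandwich bounds, the crux holds. -/
theorem crux_of_pointwiseInputs :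
    open Literature.MathematicalPhysics.QuantumLattice Literature.MathematicalPhysics.AQFT
      Literature.MathematicalPhysics.QuantumFieldTheory
      Summit.QuantumFields.YangMills.Theorems.CurvatureBoostCovariance.Negative
      Summit.QuantumFields.YangMills.Theorems.NPointIsotropy.Negative in
    (    ∀ (G : Type) [Group G] [TopologicalSpace G] [IsTopologicalGroup G] [CompactSpace G]
       [MeasurableSpace G] [BorelSpace G], IsCompactSimpleLieGroup G →
       ∀ (r : LatticeRep G) (sch : SpeciesScheme (YMSpecies G)) (S₁ : SchwingerFamily E4),
         W1 r sch S₁ → EightFrameRP S₁ → PlanarCone S₁ →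
         (∃ (K : E4 → ℝ) (C η : ℝ), 0 < η ∧ ContinuousOn K {x : E4 | x ≠ 0} ∧
           (∀ x : E4, x ≠ 0 → |K x| ≤ C * (1 + ‖x‖ ^ (η - 10))) ∧
           ∀ F : SchwartzMap (Fin 2 → E4) ℂ, IsOffDiagonal F →
             MeasureTheory.Integrable (fun x : Fin 2 → E4 => (K (x 0 - x 1) : ℂ) * F x) ∧
               S₁ 2 F = ∫ x : Fin 2 → E4, (K (x 0 - x 1) : ℂ) * F x) →
         NPointRegular S₁ ∧
         (∀ (h : OSReconstructionNoE1 S₁.toLabelled), ∃ μ C : ℝ, μ < 4 ∧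
           (∀ (u v : ℝ), 0 < u → 0 < v → u ≤ 1 → v ≤ 1 →
              ∀ (f₁ : SchwartzMap (Fin 1 → E4) ℂ) (g hh : ℝ × ℝ → ℂ) (Mg Mh Mh' : ℝ),
                (∀ x : Fin 1 → E4, f₁ x = g (x 0 0, x 0 1) * hh (x 0 2, x 0 3)) →
                (∀ p : ℝ × ℝ, g p ≠ 0 → u ≤ p.1 ∧ p.1 ≤ 2 * u) →
                MeasureTheory.Integrable g → (∫ p, ‖g p‖) ≤ Mg →
                MeasureTheory.Integrable hh → (∫ p, ‖hh p‖) ≤ Mh → (∀ p, ‖hh p‖ ≤ Mh') →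
              ∀ (n : ℕ) (W : SchwartzMap (Fin n → E4) ℂ) (hW : IsTimeOrdered W)
                (hFW : IsTimeOrdered
                  (SchwartzMap.appendTensor f₁ (translateMulti ((2 * u + v) • EuclideanSpace.single 0 1) W))),
                ‖h.fieldVec (1 + n) (fun _ => ())
                    (SchwartzMap.appendTensor f₁ (translateMulti ((2 * u + v) • EuclideanSpace.single 0 1) W)) hFW‖
                  ≤ C * Mg * (Mh + Mh') * (u ^ (-μ) + v ^ (-μ)) * ‖h.fieldVec n (fun _ => ()) W hW‖)) ∧
         (∀ (h' : OSReconstructionNoE1 (SchwingerFamily.toLabelled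
             (fun n => (S₁ n).comp (linActMulti (planeRot (0 : Fin 3) (Real.pi / 4)))))),
           ∃ μ C : ℝ, μ < 4 ∧
           (∀ (u v : ℝ), 0 < u → 0 < v → u ≤ 1 → v ≤ 1 →
              ∀ (f₁ : SchwartzMap (Fin 1 → E4) ℂ) (g hh : ℝ × ℝ → ℂ) (Mg Mh Mh' : ℝ),
                (∀ x : Fin 1 → E4, f₁ x = g (x 0 0, x 0 1) * hh (x 0 2, x 0 3)) →
                (∀ p : ℝ × ℝ, g p ≠ 0 → u ≤ p.1 ∧ p.1 ≤ 2 * u) →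
                MeasureTheory.Integrable g → (∫ p, ‖g p‖) ≤ Mg →
                MeasureTheory.Integrable hh → (∫ p, ‖hh p‖) ≤ Mh → (∀ p, ‖hh p‖ ≤ Mh') →
              ∀ (n : ℕ) (W : SchwartzMap (Fin n → E4) ℂ) (hW : IsTimeOrdered W)
                (hFW : IsTimeOrdered
                  (SchwartzMap.appendTensor f₁ (translateMulti ((2 * u + v) • EuclideanSpace.single 0 1) W))),
                ‖h'.fieldVec (1 + n) (fun _ => ())
                    (SchwartzMap.appendTensor f₁ (translateMulti ((2 * u + v) • EuclideanSpace.single 0 1) W)) hFW‖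
                  ≤ C * Mg * (Mh + Mh') * (u ^ (-μ) + v ^ (-μ)) * ‖h'.fieldVec n (fun _ => ()) W hW‖))) →
    Summit.QuantumFields.YangMills.Theses.MirrorModularBoosts.SoftKernelBoostCovariance := by
  intro hall
  rw [Summit.QuantumFields.YangMills.Theorems.SoftKernelBoostCovariance.Negative.softKernelBoostCovariance_iff]
  intro G _ _ _ _ hG
  letI : MeasurableSpace G := borel G
  haveI : BorelSpace G := ⟨rfl⟩
  intro r sch S₁ hW h8 hC hK
  obtain ⟨_, hOS, htr, hhyp, -⟩ := id hW
  obtain ⟨hreg, hSig, hSigT⟩ := hall G hG r sch S₁ hW h8 hC hK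
  exact stub_planarInvariantOfInputs S₁ hOS htr hhyp h8 hC hK hreg hSig hSigT

end Summit.QuantumFields.YangMills.Theorems.SoftKernelBoostCovariance.Sketch

end
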